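import Summits.QuantumFields.YangMills.Theorems.BalabanUVNodesN18CombStepFirstOrderBond
import Literature.MathematicalPhysics.QuantumFieldTheory.Balaban1983to89.Node00.Sect2RegionGeometry
import HarnessLib

/-!
# BalabanUVNodes ∕ node N18 = NE5 — closure-ledger item (iii), the (1.13) half of the comb-gauge step, FILE B (the frames of record):
# CONDITION (ii) FOR `(U^w, R(w)A″)` FROM THE LETTERS OF THE FIRST-ORDER SUM, ON `frameI Rz M j Y`
# (Track A, DAG node N18 = `T4OutputRate.NE5` :211; cluster K4 «SpineRates», item K3⁷ `SpineGivenEndpointR13SepCoPH`; seat pub-ymgap-dag-n18-w3 g3)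

CREDIT.  Homes §3 + §5 of the LENS seat's farm-checked scratch `ym-lens-BalabanUVNodes-transfer` g32 `LensTransferSketch32.lean` (memo `LENS-transfer.md` §38,
Card T49; bus 2026-08-27 [LENS-TRANSFER-G32-1]) per its close-out pointer «home the files … WITH CREDIT» (g35).  Located re-cut for the tree: the lens states
§3 for a frame CARRIED BY a site set `Y` through a hypothesis bundle `structure IsCarriedBy F Y : Prop`; the frames N18 reads are the frames OF RECORD
`Node00.Sect2.frameI Rz M j Y` (the lens's own §5 `isCarriedBy_frameI` case), whose carrying facts are definitional (§0 below), so this file states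
everything DIRECTLY at `frameI Rz M j Y` and no hypothesis bundle is declared.  The proofs are the lens's.

HONEST FRAMING.  Count-neutral kernel bookkeeping (`--supports stmt-QuantumFields-20544 --as helper`): Banach-algebra estimates over the tree's near-(3.29)
lineage, PROVED; nothing here is a claim about NE5, N18, the continuum limit or the mass gap.  NE5 is NOT PRINTED and NOT proved; N18 is NOT discharged.

WHY (FILE A's docstring has the full story).  The tree's near files (`B12Spaces329Near∕NearSharp`) take the frame region to be the whole lattice
(`∀ b, b ∈ F.X.bonds`); the frames of record of N18 are carried by a proper site set `Y = domSites …` (a union of cubes), and the whole-lattice hypotheses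
(`|∇^ξ_U E| ≤ δ₁` at EVERY site, `|A′| ≤ a` on EVERY bond) are not inhabitable there (a comb-gauge generator `λ̄` extended by `0` off `Y` jumps across `∂Y`).  So
everything below is stated on `frameI Rz M j Y` with the data bounded on `Y` ∕ on the bonds and stencils of `regionOfSet Y` only.

WHAT.
* §0 the carrying facts of `frameI` (bond ends, stencil ∕ plaquette corners in `Y`, cube bonds ⊆ region bonds).
* §1 `condI_congr_frameI`, `condII_congr_frameI` ((i), (ii) read the bonds of `X` only), `condIII_near_frameI` ((iii) under `v = w·exp(iξE)` with `|E| ≤ δ`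
  ON `Y`; the tree's `B12Spaces329Near.condIII_near` asks it everywhere).
* §2 ★ `condII_near_firstOrder_frameI` — (ii) = (1.13) for `(U^w, R(w)A″)`, `A″(b) = newPot ξ E(b₋) (newPot ξ A′(b) (−R(U(b))E(b₊)))`, from the letters
  `s₀, s₁` of the first-order SUM `S = E₋ + A′ − R(U)E₊`: any `α₁′ ≥ max (s₀ + 4ξδ₀(a+δ₀), s₁ + R₁)`,
  `R₁ = 4ξ(δ₀a₁ + a(2ξα₀δ₀ + δ₁)) + 4ξ((a + 9δ₀∕8)δ₁ + δ₀((1+4ξδ₀)a₁ + (1+4ξa)(2ξα₀δ₀ + δ₁)))` — the first-order content enters only through `s₀, s₁`.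
  Compare `B12Spaces329NearSharp.condII_near_sharp` (whole lattice; `α₁′ ≥ α₁ + (3 + 12α₁ + 3ξα₀)δ₀ + 4δ₁`).

0 `def`, 0 `sorry`.  References: T. Bałaban, CMP **109** (1987) 249–301 [Balaban1987RG1] ((1.11)–(1.14) p.262, (3.29) p.281); CMP **98** (1985) 17–51
[Balaban1985Averaging] ((62)–(63) p.29).
-/

namespace YMDAG.N18.CombStep

open NormedSpace
open Literature.MathematicalPhysics.QuantumFieldTheory.Balaban1983to89
open Literature.MathematicalPhysics.QuantumFieldTheory.Balaban1983to89.B12RegularSpaces111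
open Literature.MathematicalPhysics.QuantumFieldTheory.Balaban1983to89.B12RegularSpaces111Gauge
open Literature.MathematicalPhysics.QuantumFieldTheory.Balaban1983to89.B12RegularSpaces111Mono
open Literature.MathematicalPhysics.QuantumFieldTheory.Balaban1983to89.B12Membership314
open Literature.MathematicalPhysics.QuantumFieldTheory.Balaban1983to89.B12Membership313II
open Literature.MathematicalPhysics.QuantumFieldTheory.Balaban1983to89.B12Spaces329BCH
open Literature.MathematicalPhysics.QuantumFieldTheory.Balaban1983to89.B12Spaces329NearBond
open Literature.MathematicalPhysics.QuantumFieldTheory.Balaban1983to89.B12Spaces329Near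
open Literature.MathematicalPhysics.QuantumFieldTheory.Balaban1983to89.B12Spaces329NearSharp
open Complex (I)
open Literature.MathematicalPhysics.QuantumFieldTheory.Balaban1983to89.Node00
open Literature.MathematicalPhysics.QuantumFieldTheory.Balaban1983to89.Node00.Sect2

noncomputable section

variable {𝔸 : Type*} [NormedRing 𝔸] [NormedAlgebra ℂ 𝔸] [CompleteSpace 𝔸]

/-! ## §0 The frames of record `frameI Rz M j Y` are carried by the site set `Y` (lens Sketch32 §5, unbundled) -/

section Geometry

variable {P : Params} {Rz : Residual P 𝔸} {M j : ℕ} {Y : Set (Site P 0)}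

omit [NormedAlgebra ℂ 𝔸] [CompleteSpace 𝔸] in
/-- A bond of the frame of record on `Y` has both ends in `Y`. [cite: Balaban1987RG1, (1.11) p.262] -/
theorem mem_bonds_frameI_src {b : PBond P 0} (hb : b ∈ (frameI Rz M j Y).X.bonds) : b.src ∈ Y := hb.1

omit [NormedAlgebra ℂ 𝔸] [CompleteSpace 𝔸] in
/-- A bond of the frame of record on `Y` has both ends in `Y`. [cite: Balaban1987RG1, (1.11) p.262] -/
theorem mem_bonds_frameI_tgt {b : PBond P 0} (hb : b ∈ (frameI Rz M j Y).X.bonds) : b.tgt ∈ Y := hb.2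

omit [NormedAlgebra ℂ 𝔸] [CompleteSpace 𝔸] in
/-- A bond with both ends in `Y` is a bond of the frame of record on `Y`. [cite: Balaban1987RG1, (1.11) p.262] -/
theorem mem_bonds_frameI {b : PBond P 0} (h1 : b.src ∈ Y) (h2 : b.tgt ∈ Y) : b ∈ (frameI Rz M j Y).X.bonds := ⟨h1, h2⟩

omit [NormedAlgebra ℂ 𝔸] [CompleteSpace 𝔸] in
/-- A derivative stencil of the frame of record on `Y` has its four corners in `Y`. [cite: Balaban1987RG1, (1.13) p.262] -/
theorem mem_dpairs_frameI {q : Site P 0 × Fin P.d × Fin P.d} (hq : q ∈ (frameI Rz M j Y).X.dpairs) :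
    q.1 ∈ Y ∧ q.1.shift q.2.1 ∈ Y ∧ q.1.shift q.2.2 ∈ Y ∧ (q.1.shift q.2.1).shift q.2.2 ∈ Y := hq

omit [NormedAlgebra ℂ 𝔸] [CompleteSpace 𝔸] in
/-- A plaquette of the frame of record on `Y` has its four corners in `Y`. [cite: Balaban1987RG1, (1.11) p.262] -/
theorem mem_plaqs_frameI {p : Plaq P 0} (hp : p ∈ (frameI Rz M j Y).X.plaqs) :
    p.src ∈ Y ∧ p.src.shift p.μ ∈ Y ∧ p.src.shift p.ν ∈ Y ∧ (p.src.shift p.μ).shift p.ν ∈ Y := hp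

omit [NormedAlgebra ℂ 𝔸] [CompleteSpace 𝔸] in
/-- Conversely a plaquette with its four corners in `Y` is a plaquette of the frame of record on `Y`. [cite: Balaban1987RG1, (1.11) p.262] -/
theorem mem_plaqs_frameI' {p : Plaq P 0} (h1 : p.src ∈ Y) (h2 : p.src.shift p.μ ∈ Y) (h3 : p.src.shift p.ν ∈ Y)
    (h4 : (p.src.shift p.μ).shift p.ν ∈ Y) : p ∈ (frameI Rz M j Y).X.plaqs := ⟨h1, h2, h3, h4⟩

omit [NormedAlgebra ℂ 𝔸] [CompleteSpace 𝔸] in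
/-- The bonds of every (1.12) cube of the frame of record (`regionOfSet (□ ∩ Y)`) are bonds of its region (`regionOfSet_bonds_mono`).
[cite: Balaban1987RG1, (1.12) p.262] -/
theorem cubesI_bonds_subset {C : Region P 0} (hC : C ∈ (frameI Rz M j Y).cubes) : C.bonds ⊆ (frameI Rz M j Y).X.bonds := by
  obtain ⟨a, -, -, rfl⟩ := hC
  exact regionOfSet_bonds_mono Set.inter_subset_right

omit [NormedAlgebra ℂ 𝔸] [CompleteSpace 𝔸] in
/-- Lattice translations commute. [folklore] -/
private theorem shift_shift_comm (x : Site P 0) (μ ν : Fin P.d) : (x.shift μ).shift ν = (x.shift ν).shift μ := by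
  funext κ
  by_cases h1 : κ = ν
  · subst h1
    by_cases h2 : κ = μ
    · subst h2; rfl
    · simp [Site.shift, Function.update_apply, h2]
  · by_cases h2 : κ = μ
    · subst h2; simp [Site.shift, Function.update_apply, h1]
    · simp [Site.shift, Function.update_apply, h1, h2]

end Geometry

/-! ## §1 (i), (ii) read the bonds of `X` only; (iii) under a near `Gᶜ`-step with `|E| ≤ δ` on `Y` -/

section Lattice

variable {P : Params} {𝓜 : Model 𝔸}

/-- **(i) sees `U` only on the bonds of `X`** (frame of record on `Y`): plaquette variables of `X` and the (1.12) local gauges on the cubes read the bonds of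
`X` only, so (i) transfers along any `U′ = U` on `X.bonds`. -/
theorem condI_congr_frameI (Rz : Residual P 𝔸) (M j : ℕ) (Y : Set (Site P 0)) {c : StepConsts} {α₀ : ℝ}
    {U U' : PBond P 0 → 𝔸ˣ} (hUU' : ∀ b ∈ (frameI Rz M j Y).X.bonds, U' b = U b) (h : CondI 𝓜 (frameI Rz M j Y) c α₀ U) : CondI 𝓜 (frameI Rz M j Y) c α₀ U' := by
  refine ⟨fun b hb => ?_, fun p hp => ?_, fun C hC => ?_⟩
  · rw [hUU' b hb]; exact h.gValued b hb
  · obtain ⟨h0, hμ, hν, hμν⟩ := mem_plaqs_frameI hp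
    have hνμ : (p.src.shift p.ν).shift p.μ ∈ Y := by rw [← shift_shift_comm]; exact hμν
    rw [plaq_eq, hUU' ⟨p.src, p.μ⟩ (mem_bonds_frameI h0 hμ), hUU' ⟨p.src.shift p.μ, p.ν⟩ (mem_bonds_frameI hμ hμν),
      hUU' ⟨p.src.shift p.ν, p.μ⟩ (mem_bonds_frameI hν hνμ), hUU' ⟨p.src, p.ν⟩ (mem_bonds_frameI h0 hν), ← plaq_eq U p]
    exact h.plaq_lt p hp
  · obtain ⟨u, hu, A, hgauge, hA, hdA⟩ := h.localGauge C hC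
    refine ⟨u, hu, A, fun b hb => ?_, hA, hdA⟩
    rw [← hgauge b hb]
    show u b.src * U' b * (u b.tgt)⁻¹ = u b.src * U b * (u b.tgt)⁻¹
    rw [hUU' b (cubesI_bonds_subset hC hb)]

omit [CompleteSpace 𝔸] in
/-- **(ii) sees `(U, A′)` only on the bonds of `X`** (frame of record on `Y`). -/
theorem condII_congr_frameI (Rz : Residual P 𝔸) (M j : ℕ) (Y : Set (Site P 0)) {c : StepConsts} {α₁ : ℝ}
    {U U' : PBond P 0 → 𝔸ˣ} {A A' : PBond P 0 → 𝔸} (hU : ∀ b ∈ (frameI Rz M j Y).X.bonds, U' b = U b) (hA : ∀ b ∈ (frameI Rz M j Y).X.bonds, A' b = A b)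
    (h : CondII 𝓜 (frameI Rz M j Y).X c α₁ U A) : CondII 𝓜 (frameI Rz M j Y).X c α₁ U' A' := by
  refine ⟨fun b hb => ?_, fun b hb => ?_, fun q hq => ?_⟩
  · rw [hA b hb]; exact h.gcValued b hb
  · rw [hA b hb]; exact h.norm_lt b hb
  · have h' := h.nabla_lt q hq
    obtain ⟨x, μ, ν⟩ := q
    obtain ⟨hx, hxμ, hxν, hxμν⟩ := mem_dpairs_frameI hq
    dsimp only at h' ⊢
    have e : nabla c.ξ U' μ (fun y => A' ⟨y, ν⟩) x = nabla c.ξ U μ (fun y => A ⟨y, ν⟩) x := by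
      simp only [nabla]
      rw [hU ⟨x, μ⟩ (mem_bonds_frameI hx hxμ), hA ⟨x.shift μ, ν⟩ (mem_bonds_frameI hxμ hxμν), hA ⟨x, ν⟩ (mem_bonds_frameI hx hxν)]
    rw [e]
    exact h'

/-- **(iii) under `v = w·exp(iξE)`, frame of record on `Y`, `|E| ≤ δ` ON `Y`** (the tree's `B12Spaces329Near.condIII_near` asks `|E| ≤ δ` everywhere):
`∂(𝐔^v)(p) = w(x)e(x)·∂𝐔(p)·(w(x)e(x))⁻¹`, `x = p.src ∈ Y`; `R(v)𝐉(b)` is conjugation at `b.src ∈ Y`; conjugation by `e(x)` costs `e^{2ξ|E(x)|}`. -/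
theorem condIII_near_frameI {G : Subgroup 𝔸ˣ} (hG1 : ∀ g ∈ G, ‖(g : 𝔸)‖ ≤ 1) (Rz : Residual P 𝔸) (M j : ℕ) (Y : Set (Site P 0))
    {c : StepConsts} (hξ : 0 ≤ c.ξ) {α₀ γ₀ δ α₀' γ₀' : ℝ} (hα₀ : 0 ≤ α₀)
    (hα₀' : Real.exp (2 * (c.ξ * δ)) * α₀ ≤ α₀') (hγ₀' : Real.exp (2 * (c.ξ * δ)) * γ₀ ≤ γ₀') {Uc : PBond P 0 → 𝔸ˣ}
    {Jc : PBond P 0 → 𝔸} {w : Site P 0 → 𝔸ˣ} (hw : ∀ x, w x ∈ G) {E : Site P 0 → 𝔸} (hE : ∀ x ∈ Y, ‖E x‖ ≤ δ)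
    (h : CondIII (frameI Rz M j Y).X c α₀ γ₀ Uc Jc) :
    CondIII (frameI Rz M j Y).X c α₀' γ₀' (gaugeU (w * fun x => expI c.ξ (E x)) Uc) (adJ (w * fun x => expI c.ξ (E x)) Jc) := by
  have hexp : ∀ x ∈ Y, Real.exp (2 * (c.ξ * ‖E x‖)) ≤ Real.exp (2 * (c.ξ * δ)) := fun x hx =>
    Real.exp_le_exp.mpr (by nlinarith [hE x hx, norm_nonneg (E x)])
  refine ⟨fun p hp => ?_, fun b hb => ?_⟩
  · have hsrc : p.src ∈ Y := (mem_plaqs_frameI hp).1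
    rw [gaugeU_mul, plaq_gaugeU, plaq_gaugeU, Units.val_mul, Units.val_mul, norm_conj_sub_one_eq hG1 (hw p.src),
      Units.val_mul, Units.val_mul]
    have hlt := h.plaq_lt p hp
    calc ‖(expI c.ξ (E p.src) : 𝔸) * ↑(plaq Uc p) * ↑(expI c.ξ (E p.src))⁻¹ - 1‖
        ≤ Real.exp (2 * (c.ξ * ‖E p.src‖)) * ‖(↑(plaq Uc p) : 𝔸) - 1‖ := norm_conj_expI_sub_one_le hξ _ _
      _ < Real.exp (2 * (c.ξ * ‖E p.src‖)) * (α₀ * c.ξ ^ 2) := mul_lt_mul_of_pos_left hlt (Real.exp_pos _)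
      _ ≤ Real.exp (2 * (c.ξ * δ)) * (α₀ * c.ξ ^ 2) := mul_le_mul_of_nonneg_right (hexp _ hsrc) (by positivity)
      _ ≤ α₀' * c.ξ ^ 2 := by rw [← mul_assoc]; exact mul_le_mul_of_nonneg_right hα₀' (sq_nonneg _)
  · have hsrc : b.src ∈ Y := mem_bonds_frameI_src hb
    rw [adJ_mul]
    show ‖(w b.src : 𝔸) * adJ (fun x => expI c.ξ (E x)) Jc b * ↑(w b.src)⁻¹‖ < γ₀'
    rw [norm_conj_eq hG1 (hw b.src)]
    have hlt := h.J_lt b hb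
    have hγ₀ : 0 < γ₀ := (norm_nonneg _).trans_lt hlt
    calc ‖adJ (fun x => expI c.ξ (E x)) Jc b‖ = ‖(expI c.ξ (E b.src) : 𝔸) * Jc b * ↑(expI c.ξ (E b.src))⁻¹‖ := rfl
      _ ≤ Real.exp (2 * (c.ξ * ‖E b.src‖)) * ‖Jc b‖ := norm_conj_expI_le hξ _ _
      _ < Real.exp (2 * (c.ξ * ‖E b.src‖)) * γ₀ := mul_lt_mul_of_pos_left hlt (Real.exp_pos _)
      _ ≤ Real.exp (2 * (c.ξ * δ)) * γ₀ := mul_le_mul_of_nonneg_right (hexp _ hsrc) hγ₀.le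
      _ ≤ γ₀' := hγ₀'

/-! ## §2 ★ (ii) for `(U^w, R(w)A″)` in first-order-sum form on the frame of record -/

/-- ★ **(ii) for `(U^w, R(w)A″)` in first-order-sum form, frame of record on `Y`.**  Data: the `G`-valued factor `U` with (i) at `α₀` on the frame,
`A′` `𝔤ᶜ`-valued with `|A′| ≤ a` on the bonds of `X` and `|∇^ξ_U A′| ≤ a₁` on its stencils (NO (ii)-budget asked of `A′` itself), a `G`-valued `w`,
`E` `𝔤ᶜ`-valued with `|E| ≤ δ₀` on `Y` and `|∇^ξ_{U,μ}E(x)| ≤ δ₁` whenever `x, x+μ ∈ Y`, the regime `ξ(a + 2δ₀) ≤ 1/16`, and the LETTERS OF THE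
FIRST-ORDER SUM `S(b) = E(b₋) + A′(b) − R(U(b))E(b₊)`: `|S| < s₀` on the bonds, `|∇^ξ_U S| < s₁` on the stencils of `X`.  Then `(U^w, R(w)A″)`,
`A″(b) = newPot ξ E(b₋) (newPot ξ A′(b) (−R(U(b))E(b₊)))`, satisfy (ii) = (1.13) on `X` with any `α₁′ ≥ max (s₀ + 4ξδ₀(a + δ₀), s₁ + R₁)`,
`R₁ = 4ξ(δ₀a₁ + a(2ξα₀δ₀ + δ₁)) + 4ξ((a + 9δ₀/8)δ₁ + δ₀((1+4ξδ₀)a₁ + (1+4ξa)(2ξα₀δ₀ + δ₁)))` — the first-order content enters only through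
`s₀, s₁`; every other term carries a factor `ξ(a + δ₀)`.  Compare `B12Spaces329NearSharp.condII_near_sharp` (whole lattice;
`α₁′ ≥ α₁ + (3 + 12α₁ + 3ξα₀)δ₀ + 4δ₁` from the (ii)-budget `α₁` of `A′`, the three constituents bounded separately). -/
theorem condII_near_firstOrder_frameI (hG1 : ∀ g ∈ 𝓜.G, ‖(g : 𝔸)‖ ≤ 1)
    (hgc : ∀ g ∈ 𝓜.G, ∀ X ∈ 𝓜.gc, (g : 𝔸) * X * ↑g⁻¹ ∈ 𝓜.gc)
    {c : StepConsts} (hgcN : ∀ X ∈ 𝓜.gc, ∀ Y ∈ 𝓜.gc, c.ξ * (‖X‖ + ‖Y‖) ≤ 1 / 4 → newPot c.ξ X Y ∈ 𝓜.gc)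
    (Rz : Residual P 𝔸) (M j : ℕ) (Y : Set (Site P 0)) (hξ : 0 < c.ξ)
    {α₀ a a₁ δ₀ δ₁ s₀ s₁ α₁' : ℝ} (hα₀ : 0 ≤ α₀) (ha : 0 ≤ a) (hδ₀ : 0 ≤ δ₀)
    (hs : c.ξ * (a + 2 * δ₀) ≤ 1 / 16)
    (hα₁'0 : s₀ + 4 * c.ξ * δ₀ * (a + δ₀) ≤ α₁')
    (hα₁'1 : s₁ + (4 * c.ξ * (δ₀ * a₁ + a * (2 * c.ξ * α₀ * δ₀ + δ₁)) +
        4 * c.ξ * ((a + (9 / 8) * δ₀) * δ₁ +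
          δ₀ * ((1 + 4 * (c.ξ * δ₀)) * a₁ + (1 + 4 * (c.ξ * a)) * (2 * c.ξ * α₀ * δ₀ + δ₁)))) ≤ α₁')
    {U : PBond P 0 → 𝔸ˣ} {A' : PBond P 0 → 𝔸} (hI : CondI 𝓜 (frameI Rz M j Y) c α₀ U) (hAgc : ∀ b ∈ (frameI Rz M j Y).X.bonds, A' b ∈ 𝓜.gc)
    (hA : ∀ b ∈ (frameI Rz M j Y).X.bonds, ‖A' b‖ ≤ a) (hA1 : ∀ q ∈ (frameI Rz M j Y).X.dpairs, ‖nabla c.ξ U q.2.1 (fun y => A' ⟨y, q.2.2⟩) q.1‖ ≤ a₁)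
    {w : Site P 0 → 𝔸ˣ} (hw : ∀ x, w x ∈ 𝓜.G) {E : Site P 0 → 𝔸} (hEgc : ∀ x ∈ Y, E x ∈ 𝓜.gc)
    (hE0 : ∀ x ∈ Y, ‖E x‖ ≤ δ₀) (hE1 : ∀ (x : Site P 0) (μ : Fin P.d), x ∈ Y → x.shift μ ∈ Y → ‖nabla c.ξ U μ E x‖ ≤ δ₁)
    (hS0 : ∀ b ∈ (frameI Rz M j Y).X.bonds, ‖E b.src + A' b + (U b : 𝔸) * (-E b.tgt) * ↑(U b)⁻¹‖ < s₀)
    (hS1 : ∀ q ∈ (frameI Rz M j Y).X.dpairs, ‖nabla c.ξ U q.2.1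
      (fun y => E y + A' ⟨y, q.2.2⟩ + (U ⟨y, q.2.2⟩ : 𝔸) * (-E (y.shift q.2.2)) * ↑(U ⟨y, q.2.2⟩)⁻¹) q.1‖ < s₁) :
    CondII 𝓜 (frameI Rz M j Y).X c α₁' (gaugeU w U)
      (adJ w fun b => newPot c.ξ (E b.src) (newPot c.ξ (A' b) ((U b : 𝔸) * (-E b.tgt) * ↑(U b)⁻¹))) := by
  -- standing facts
  have hUG : ∀ b ∈ (frameI Rz M j Y).X.bonds, U b ∈ 𝓜.G := hI.gValued
  have hTn : ∀ b ∈ (frameI Rz M j Y).X.bonds, ∀ y ∈ Y, ‖(U b : 𝔸) * (-E y) * ↑(U b)⁻¹‖ ≤ δ₀ := fun b hb y hy => by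
    rw [norm_conj_eq hG1 (hUG b hb), norm_neg]; exact hE0 y hy
  have hξa : c.ξ * a ≤ 1 / 16 := by nlinarith
  have hξδ : c.ξ * δ₀ ≤ 1 / 32 := by nlinarith
  -- abbreviations: `T b = −R(U(b))E(b₊)`, `N b = newPot ξ A′(b) (T b)`; the two BCH ranges on the bonds of `X`
  set T : PBond P 0 → 𝔸 := fun b => (U b : 𝔸) * (-E b.tgt) * ↑(U b)⁻¹ with hTdef
  set N : PBond P 0 → 𝔸 := fun b => newPot c.ξ (A' b) (T b) with hNdef
  have h2b : ∀ b ∈ (frameI Rz M j Y).X.bonds, c.ξ * (‖A' b‖ + ‖T b‖) ≤ 1 / 16 :=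
    fun b hb => (norm_newPot2_le_sharp hG1 hξ ha hδ₀ hs (hUG b hb) (hE0 _ (mem_bonds_frameI_tgt hb)) (hA b hb)).1
  have h3b : ∀ b ∈ (frameI Rz M j Y).X.bonds, c.ξ * (‖E b.src‖ + ‖N b‖) ≤ 1 / 8 :=
    fun b hb => (norm_newPot3_le_sharp hG1 hξ ha hδ₀ hs (hUG b hb) (hE0 _ (mem_bonds_frameI_src hb)) (hE0 _ (mem_bonds_frameI_tgt hb))
      (hA b hb)).1
  refine ⟨fun b hb => ?_, fun b hb => ?_, fun q hq => ?_⟩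
  · -- «A″ has values in the algebra 𝔤ᶜ» on `X`
    show (w b.src : 𝔸) * newPot c.ξ (E b.src) (N b) * ↑(w b.src)⁻¹ ∈ 𝓜.gc
    refine hgc _ (hw _) _ (hgcN _ (hEgc _ (mem_bonds_frameI_src hb)) _
      (hgcN _ (hAgc b hb) _ ?_ ((h2b b hb).trans (by norm_num))) ((h3b b hb).trans (by norm_num)))
    exact hgc _ (hUG b hb) _ (𝓜.gc.neg_mem (hEgc _ (mem_bonds_frameI_tgt hb)))
  · -- `|A″| < α₁′` on `X`: `|A″(b)| ≤ |S(b)| + 4ξδ₀(a + δ₀)`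
    show ‖(w b.src : 𝔸) * newPot c.ξ (E b.src) (N b) * ↑(w b.src)⁻¹‖ < α₁'
    rw [norm_conj_eq hG1 (hw _)]
    have hR := norm_newPot3_sub_firstOrder_le hG1 hξ ha hδ₀ hs (hUG b hb) (hE0 _ (mem_bonds_frameI_src hb))
      (hE0 _ (mem_bonds_frameI_tgt hb)) (hA b hb)
    calc ‖newPot c.ξ (E b.src) (N b)‖
        ≤ ‖E b.src + A' b + T b‖ + ‖newPot c.ξ (E b.src) (N b) - (E b.src + A' b + T b)‖ := norm_le_norm_add_norm_sub' _ _
      _ < s₀ + 4 * c.ξ * δ₀ * (a + δ₀) := add_lt_add_of_lt_of_le (hS0 b hb) hR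
      _ ≤ α₁' := hα₁'0
  · -- `|∇^ξ_{U^w}A″| < α₁′` on the stencils of `X`: `|∇A″| ≤ |∇S| + R₁`
    have hdA' := hA1 q hq
    have hS' := hS1 q hq
    obtain ⟨x, μ, ν⟩ := q
    obtain ⟨hx, hxμ, hxν, hxμν⟩ := mem_dpairs_frameI hq
    dsimp only at hdA' hS' ⊢
    have hcomm : (x.shift μ).shift ν = (x.shift ν).shift μ := shift_shift_comm x μ ν
    have hxνμ : (x.shift ν).shift μ ∈ Y := by rw [← hcomm]; exact hxμν
    have hb1 : (⟨x, μ⟩ : PBond P 0) ∈ (frameI Rz M j Y).X.bonds := mem_bonds_frameI hx hxμ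
    have hb2 : (⟨x, ν⟩ : PBond P 0) ∈ (frameI Rz M j Y).X.bonds := mem_bonds_frameI hx hxν
    have hb3 : (⟨x.shift μ, ν⟩ : PBond P 0) ∈ (frameI Rz M j Y).X.bonds := mem_bonds_frameI hxμ hxμν
    have hb4 : (⟨x.shift ν, μ⟩ : PBond P 0) ∈ (frameI Rz M j Y).X.bonds := mem_bonds_frameI hxν hxνμ
    rw [nabla_gaugeU_adJ, norm_conj_eq hG1 (hw _)]
    -- (a) the transported field: `‖∇_μ T_ν(x)‖ ≤ 2ξα₀δ₀ + δ₁` (a conjugated plaquette of `U`, as in `condII_near_sharp`)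
    have hW : ‖(((U ⟨x, ν⟩)⁻¹ * U ⟨x, μ⟩ * U ⟨x.shift μ, ν⟩ * (U ⟨x.shift ν, μ⟩)⁻¹ : 𝔸ˣ) : 𝔸) - 1‖ ≤ α₀ * c.ξ ^ 2 := by
      rcases lt_trichotomy μ ν with hμν | rfl | hνμ
      · rw [norm_loop_sub_one_eq hG1 (hUG _ hb2), ← plaq_eq U ⟨x, μ, ν, hμν⟩]
        exact (hI.plaq_lt ⟨x, μ, ν, hμν⟩ (mem_plaqs_frameI' hx hxμ hxν hxμν)).le
      · rw [loop_eq_one_of_eq, Units.val_one, sub_self, norm_zero]; positivity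
      · refine (norm_loop_sub_one_le_of_gt hG1 (hUG _ hb1) (hUG _ hb2) (hUG _ hb3) (hUG _ hb4)).trans ?_
        rw [← plaq_eq U ⟨x, ν, μ, hνμ⟩]
        exact (hI.plaq_lt ⟨x, ν, μ, hνμ⟩ (mem_plaqs_frameI' hx hxν hxμ hxνμ)).le
    have hT : ‖(c.ξ : ℂ)⁻¹ • ((U ⟨x, μ⟩ : 𝔸) * ((U ⟨x.shift μ, ν⟩ : 𝔸) * (-E ((x.shift μ).shift ν)) * ↑(U ⟨x.shift μ, ν⟩)⁻¹) *
        ↑(U ⟨x, μ⟩)⁻¹ - (U ⟨x, ν⟩ : 𝔸) * (-E (x.shift ν)) * ↑(U ⟨x, ν⟩)⁻¹)‖ ≤ 2 * c.ξ * α₀ * δ₀ + δ₁ := by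
      have h := norm_covD_transport_le hG1 hξ (hUG _ hb1) (hUG _ hb2) (hUG _ hb3) (hUG _ hb4) (E (x.shift ν))
        (E ((x.shift μ).shift ν))
      have hn : (c.ξ : ℂ)⁻¹ • ((U ⟨x.shift ν, μ⟩ : 𝔸) * E ((x.shift μ).shift ν) * ↑(U ⟨x.shift ν, μ⟩)⁻¹ - E (x.shift ν)) =
          nabla c.ξ U μ E (x.shift ν) := by rw [hcomm]; rfl
      rw [hn] at h
      refine h.trans ?_
      have h1 : 2 * c.ξ⁻¹ * ‖(((U ⟨x, ν⟩)⁻¹ * U ⟨x, μ⟩ * U ⟨x.shift μ, ν⟩ * (U ⟨x.shift ν, μ⟩)⁻¹ : 𝔸ˣ) : 𝔸) - 1‖ *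
          ‖E ((x.shift μ).shift ν)‖ ≤ 2 * c.ξ⁻¹ * (α₀ * c.ξ ^ 2) * δ₀ := by
        gcongr
        exact hE0 _ hxμν
      have h2 : 2 * c.ξ⁻¹ * (α₀ * c.ξ ^ 2) * δ₀ = 2 * c.ξ * α₀ * δ₀ := by
        field_simp
      linarith [hE1 (x.shift ν) μ hxν hxνμ]
    -- (b) the remainder of the identity, with its three derivative letters bounded by `a₁`, `2ξα₀δ₀ + δ₁`, `δ₁`
    have hrem := norm_covD_newPot3_sub_covD_firstOrder_le hG1 hξ ha hδ₀ hs (hUG _ hb1) (hE0 x hx) (hE0 _ hxμ)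
      (hA _ hb2) (hA _ hb3) (hTn _ hb2 _ hxν) (hTn _ hb3 _ hxμν)
    have hdX : ‖(c.ξ : ℂ)⁻¹ • ((U ⟨x, μ⟩ : 𝔸) * E (x.shift μ) * ↑(U ⟨x, μ⟩)⁻¹ - E x)‖ ≤ δ₁ := hE1 x μ hx hxμ
    have hdA : ‖(c.ξ : ℂ)⁻¹ • ((U ⟨x, μ⟩ : 𝔸) * A' ⟨x.shift μ, ν⟩ * ↑(U ⟨x, μ⟩)⁻¹ - A' ⟨x, ν⟩)‖ ≤ a₁ := hdA'
    have hrem' : ‖(c.ξ : ℂ)⁻¹ • (((U ⟨x, μ⟩ : 𝔸) * newPot c.ξ (E (x.shift μ)) (N ⟨x.shift μ, ν⟩) * ↑(U ⟨x, μ⟩)⁻¹ -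
          newPot c.ξ (E x) (N ⟨x, ν⟩)) -
        ((U ⟨x, μ⟩ : 𝔸) * (E (x.shift μ) + A' ⟨x.shift μ, ν⟩ + T ⟨x.shift μ, ν⟩) * ↑(U ⟨x, μ⟩)⁻¹ -
          (E x + A' ⟨x, ν⟩ + T ⟨x, ν⟩)))‖ ≤
        4 * c.ξ * (δ₀ * a₁ + a * (2 * c.ξ * α₀ * δ₀ + δ₁)) +
          4 * c.ξ * ((a + (9 / 8) * δ₀) * δ₁ +
            δ₀ * ((1 + 4 * (c.ξ * δ₀)) * a₁ + (1 + 4 * (c.ξ * a)) * (2 * c.ξ * α₀ * δ₀ + δ₁))) := by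
      refine hrem.trans ?_
      gcongr
    -- (c) the first-order sum's letter
    have hS : ‖(c.ξ : ℂ)⁻¹ • ((U ⟨x, μ⟩ : 𝔸) * (E (x.shift μ) + A' ⟨x.shift μ, ν⟩ + T ⟨x.shift μ, ν⟩) * ↑(U ⟨x, μ⟩)⁻¹ -
        (E x + A' ⟨x, ν⟩ + T ⟨x, ν⟩))‖ < s₁ := hS'
    -- (d) assembly
    have key : (c.ξ : ℂ)⁻¹ • ((U ⟨x, μ⟩ : 𝔸) * newPot c.ξ (E (x.shift μ)) (N ⟨x.shift μ, ν⟩) * ↑(U ⟨x, μ⟩)⁻¹ -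
          newPot c.ξ (E x) (N ⟨x, ν⟩)) =
        (c.ξ : ℂ)⁻¹ • ((U ⟨x, μ⟩ : 𝔸) * (E (x.shift μ) + A' ⟨x.shift μ, ν⟩ + T ⟨x.shift μ, ν⟩) * ↑(U ⟨x, μ⟩)⁻¹ -
            (E x + A' ⟨x, ν⟩ + T ⟨x, ν⟩)) +
          (c.ξ : ℂ)⁻¹ • (((U ⟨x, μ⟩ : 𝔸) * newPot c.ξ (E (x.shift μ)) (N ⟨x.shift μ, ν⟩) * ↑(U ⟨x, μ⟩)⁻¹ -
              newPot c.ξ (E x) (N ⟨x, ν⟩)) -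
            ((U ⟨x, μ⟩ : 𝔸) * (E (x.shift μ) + A' ⟨x.shift μ, ν⟩ + T ⟨x.shift μ, ν⟩) * ↑(U ⟨x, μ⟩)⁻¹ -
              (E x + A' ⟨x, ν⟩ + T ⟨x, ν⟩))) := by
      rw [← smul_add]; congr 1; abel
    calc ‖nabla c.ξ U μ (fun y => newPot c.ξ (E (⟨y, ν⟩ : PBond P 0).src) (N ⟨y, ν⟩)) x‖
        = ‖(c.ξ : ℂ)⁻¹ • ((U ⟨x, μ⟩ : 𝔸) * newPot c.ξ (E (x.shift μ)) (N ⟨x.shift μ, ν⟩) * ↑(U ⟨x, μ⟩)⁻¹ -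
            newPot c.ξ (E x) (N ⟨x, ν⟩))‖ := rfl
      _ ≤ ‖(c.ξ : ℂ)⁻¹ • ((U ⟨x, μ⟩ : 𝔸) * (E (x.shift μ) + A' ⟨x.shift μ, ν⟩ + T ⟨x.shift μ, ν⟩) * ↑(U ⟨x, μ⟩)⁻¹ -
              (E x + A' ⟨x, ν⟩ + T ⟨x, ν⟩))‖ +
            ‖(c.ξ : ℂ)⁻¹ • (((U ⟨x, μ⟩ : 𝔸) * newPot c.ξ (E (x.shift μ)) (N ⟨x.shift μ, ν⟩) * ↑(U ⟨x, μ⟩)⁻¹ -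
                newPot c.ξ (E x) (N ⟨x, ν⟩)) -
              ((U ⟨x, μ⟩ : 𝔸) * (E (x.shift μ) + A' ⟨x.shift μ, ν⟩ + T ⟨x.shift μ, ν⟩) * ↑(U ⟨x, μ⟩)⁻¹ -
                (E x + A' ⟨x, ν⟩ + T ⟨x, ν⟩)))‖ := by
          rw [key]; exact norm_add_le _ _
      _ < s₁ + (4 * c.ξ * (δ₀ * a₁ + a * (2 * c.ξ * α₀ * δ₀ + δ₁)) +
            4 * c.ξ * ((a + (9 / 8) * δ₀) * δ₁ +
              δ₀ * ((1 + 4 * (c.ξ * δ₀)) * a₁ + (1 + 4 * (c.ξ * a)) * (2 * c.ξ * α₀ * δ₀ + δ₁)))) :=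
          add_lt_add_of_lt_of_le hS hrem'
      _ ≤ α₁' := hα₁'1

end Lattice

end

end YMDAG.N18.CombStep
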